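import Summits.QuantumFields.YangMills.Theorems.SwapVirialDeficitBlowUpGnomonicTipRotTransverse
import Summits.QuantumFields.YangMills.Theorems.SwapVirialDeficitBlowUpGnomonicCartHubBasics
import Mathlib.MeasureTheory.Constructions.Pi
import HarnessLib

/-!
# The aligned frame at a fixed leader: rotating the other letters and splitting `ℝ³ = ℝ × ℝ²`

Sub-problem `SwapVirialDeficit`, crux ⟨stmt-QuantumFields-24197⟩ `SwapGluedStiffness`, skeleton ➎, stub `stub_core_tip`, socket (hCore); helpers for file F5 of w2 g61's
aligned-rotation assembly (HOME memo `w2-g61-memo-hCore-S3S4-aligned.md` §2, LEAD g100 (B8)): at fixed `x ≠ 0` one substitutes `y = rot3 u_x Y` with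
`rot3 u_x e₀ = x̂` (✓`exists_rot3_e0_eq`), and reads `Y = (b, w̃)` with `b = y·x̂`, `|w̃|² = |y|² − (y·x̂)²`:
* `lintegral_rot3_comp` — `∫⁻ y, G y = ∫⁻ Y, G (rot3 u Y)` (✓`volume_preserving_rot3`);
* `rot3_frame_coords` — for `rot3 u e₀ = n` (unit `u`): `⟨rot3 u Y, n⟩ = Y₀` and `|rot3 u Y|² − ⟨rot3 u Y, n⟩² = Y₁² + Y₂²` (✓`dot3_rot3`, ✓`normSq3_rot3`);
* `lintegral_fin3_eq_lintegral_prod` — `∫⁻ y : Fin 3 → ℝ, G y = ∫⁻ b : ℝ, ∫⁻ w : Fin 2 → ℝ, G (e₀⁻¹ (b, w))`, `e₀ = MeasurableEquiv.piFinSuccAbove _ 0`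
  (`(e₀⁻¹(b,w)) 0 = b`, `(e₀⁻¹(b,w)) 1 = w 0`, `(e₀⁻¹(b,w)) 2 = w 1`: `piFinSuccAbove_symm_coords`).

HONEST LABEL: measure bookkeeping only; (hCore), `stub_core_tip`, ⟨24197⟩, ⟨24194⟩ remain OPEN; nothing here proves the Yang–Mills mass gap.
-/

noncomputable section

open MeasureTheory Quaternion Set
open scoped Quaternion BigOperators ENNReal
open Literature.MathematicalPhysics.QuantumLattice
open Literature.MathematicalPhysics.QuantumFieldTheory hiding SU2

namespace Summit.QuantumFields.YangMills.Theorems.SwapVirialDeficit.BlowUpRing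

open Summit.QuantumFields.YangMills.Theorems.FemtoTransferGap
open Summit.QuantumFields.YangMills.Theorems.FemtoTransferGap.TT
open Summit.QuantumFields.YangMills.Theorems.SwapVirialDeficit.Gnomonic (normSq3)

variable {L : ℕ}

/-- `∫⁻ y, G y = ∫⁻ Y, G (rot3 u Y)` for a unit `u` and measurable `G`. [folklore] -/
theorem lintegral_rot3_comp {u : ℍ} (hu : ‖u‖ = 1) {G : (Fin 3 → ℝ) → ℝ≥0∞} (hG : Measurable G) :
    ∫⁻ y : Fin 3 → ℝ, G y = ∫⁻ Y : Fin 3 → ℝ, G (rot3 u Y) :=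
  ((volume_preserving_rot3 hu).lintegral_comp hG).symm

/-- ★ **FRAME COORDINATES**: if `rot3 u e₀ = n` (unit `u`) then for every `Y`, `Σᵢ (rot3 u Y)ᵢ nᵢ = Y 0` and
`|rot3 u Y|² − (Σᵢ (rot3 u Y)ᵢ nᵢ)² = Y₁² + Y₂²`. [folklore] -/
theorem rot3_frame_coords {u : ℍ} (hu : ‖u‖ = 1) {n : Fin 3 → ℝ} (hn : rot3 u ![1, 0, 0] = n) (Y : Fin 3 → ℝ) :
    ∑ i, rot3 u Y i * n i = Y 0 ∧ normSq3 (rot3 u Y) - (∑ i, rot3 u Y i * n i) ^ 2 = Y 1 ^ 2 + Y 2 ^ 2 := by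
  have h1 : ∑ i, rot3 u Y i * n i = Y 0 := by
    rw [← hn, dot3_rot3 hu Y ![1, 0, 0], Fin.sum_univ_three]
    simp
  refine ⟨h1, ?_⟩
  rw [h1, normSq3_rot3 hu, normSq3_eq_three']
  ring

/-- The coordinates of `e₀⁻¹ (b, w)` for `e₀ = MeasurableEquiv.piFinSuccAbove (fun _ => ℝ) 0`. [folklore] -/
theorem piFinSuccAbove_symm_coords (b : ℝ) (w : Fin 2 → ℝ) :
    (MeasurableEquiv.piFinSuccAbove (fun _ : Fin 3 => ℝ) 0).symm (b, w) 0 = b ∧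
      (MeasurableEquiv.piFinSuccAbove (fun _ : Fin 3 => ℝ) 0).symm (b, w) 1 = w 0 ∧
      (MeasurableEquiv.piFinSuccAbove (fun _ : Fin 3 => ℝ) 0).symm (b, w) 2 = w 1 := by
  refine ⟨?_, ?_, ?_⟩ <;> simp [MeasurableEquiv.piFinSuccAbove, Fin.insertNthEquiv]
  rfl

/-- ★ **SPLITTING `ℝ³ = ℝ × ℝ²`**: `∫⁻ y, G y = ∫⁻ b, ∫⁻ w, G (e₀⁻¹ (b, w))` for measurable `G ≥ 0`. [folklore] -/
theorem lintegral_fin3_eq_lintegral_prod {G : (Fin 3 → ℝ) → ℝ≥0∞} (hG : Measurable G) :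
    ∫⁻ y : Fin 3 → ℝ, G y = ∫⁻ b : ℝ, ∫⁻ w : Fin 2 → ℝ, G ((MeasurableEquiv.piFinSuccAbove (fun _ : Fin 3 => ℝ) 0).symm (b, w)) := by
  set e := MeasurableEquiv.piFinSuccAbove (fun _ : Fin 3 => ℝ) 0 with he
  have hT : MeasurePreserving e volume volume := volume_preserving_piFinSuccAbove (fun _ : Fin 3 => ℝ) 0
  have hGs : Measurable fun q : ℝ × (Fin 2 → ℝ) => G (e.symm q) := hG.comp e.symm.measurable
  have h1 : ∫⁻ y : Fin 3 → ℝ, G y = ∫⁻ q : ℝ × (Fin 2 → ℝ), G (e.symm q) := by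
    rw [← hT.lintegral_comp hGs]
    simp
  rw [h1, show (volume : Measure (ℝ × (Fin 2 → ℝ))) = (volume : Measure ℝ).prod volume from rfl, lintegral_prod _ hGs.aemeasurable]

end Summit.QuantumFields.YangMills.Theorems.SwapVirialDeficit.BlowUpRing

end
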